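import Summits.BirchSwinnertonDyer.Rank1Residual.Partition.MainConjecturesAnticyclotomicGood
import Summits.BirchSwinnertonDyer.Rank1Residual.X11b.RouteP2OpenInputFromPrint
import HarnessLib

/-!
# A GOOD prime `p ≥ 5` on a semistable curve: the composite link (IMC≥∘BDP)ᵍ SPLIT INTO HALVES,
# pointwise — the value at `𝟙` from Castella 2018 Thms. 3.1–3.2 (A222, no ordinarity hypothesis),
# the one-sided divisibility `Ch_Λ(X_ac)·R₀⟦T⟧ ⊆ (L)` over Castella's frame as the other half
# (cell `b2b-bsdres`, literature typer seat `lit-cw` = Castella–Wan / Wan-line papers, gen 13;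
# companion `Supersingular/X6RankOneHalvesFromPrint.lean` consumes it on class X6)

HONEST FRAMING (cell `b2b-bsdres`, run/shared/lean/b2b/bsd-rank1-residual/, verbatim in every
file): the goal of the cell is to DELETE the COMBINATION-SHAPED residual classes of the
Birch–Swinnerton-Dyer formula for ALL analytic-rank `≤ 1` elliptic curves over `ℚ` — "full BSD
formula for every rank `≤ 1` curve in class `C`" assembled STRICTLY from published theorems — so
that the rank-`≤ 1` remainder becomes exactly the CONSTRUCTION-SHAPED classes, which are TYPED
(missing-input `Prop`s), NOT attempted. This is not "finishing BSD". Research routes; no claim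
beyond stated classes. THEOREMS ONLY (no definition, no named fact, no `sorry`); nothing booked; no
label is moved by this file. NEW WORK of the cell, hence under `Summits/`.

## What is proved (theorems only; the good-`p` twin of multr1's route-p2 split
## `X11b/RouteP2OpenInputFromPrint.lean` and of team x11b3's `X11b/HalvesReceptacle.lean` §1–§2)

lit-glue typed the composite link (IMC≥∘BDP)ᵍ `X11b.IMCLowerWaldspurgerOnTreeGoodAt p κ 𝔭 γ ι P` —
"`2·(ord_p log_ω P + ord_p(1 − a_p + p) − 1) ≤ ord_p f_ac(0)`" on the constructed `X_ac^∅(E_K[p^∞])`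
(`Partition/MainConjecturesAnticyclotomicGood.lean`) — with Castella's `L_p(f)(𝟙)` ELIMINATED because
the tree then had no `L_p(f)`. The tree now has Castella's frame `IsBDPLFunction` (A206) and the
PUBLISHED fact `Castella2018.thm32_exists_isBDPLFunction_valueAtOne` (registry A222: Cas18 Thm. 3.2
jointly with Thm. 3.1, `∃∧`-currency), printed for "`E` semistable, `p ≥ 5`, `ρ̄_{E,p}` irreducible,
`K` with `p` split and (Heeg)", "`ε_p = p⁻¹` if `p ∤ N`" — NO ordinarity hypothesis (Cas18 §2.1, §3,
arXiv:1704.06608 pp. 5, 9): it applies verbatim at a good SUPERSINGULAR `p ≥ 5` (class X6) as well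
as at a good ordinary one. Here, for every good `p`:

* §1 the algebra (every `p`): `f ∈ Λ`, `f(0) ≠ 0`, `f ↦ (L)` in `R₀⟦T⟧`, `L(0) = u·y²`, `u ∈ R₀ˣ` ⟹
  `y ≠ 0 ∧ 2·ord_p y ≤ ord_p f(0)` (`two_mul_valuation_le_of_mem_span` — the `y`-general form of
  `Halves.two_mul_sub_one_le_valuation`, which spends the bound `‖1 − a p⁻¹‖ ≤ p`; here the Euler-type
  factor stays inside `y` and its EXACT valuation `ord_p(1 − a p⁻¹ + p⁻¹) = ord_p(1 − a + p) − 1` is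
  read off afterwards, `valuation_one_sub_div_add_inv`);
* §2 pointwise (every embedding `ι : K → ℚ_p`): CTL₀ (`HasCharValuationAt n`) ∧ the divisibility
  `Ch_Λ(X_ac)·R₀⟦T⟧ ⊆ (L)` ∧ the good-`p` value shape `L(0) = u·((1 − a_p(E) p⁻¹ + p⁻¹)·log_{ω_E} P)²`
  ⟹ `X11b.IMCLowerWaldspurgerOnTreeGoodAt p κ 𝔭 γ ι P` with the SAME `n`
  (`imcLowerWaldspurgerOnTreeGoodAt_of_value_of_dvd`; `a_p(E) = W.LFunction p = frobeniusTrace` of the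
  minimal model at a good prime, `LFunction_apply_prime_eq_frobeniusTrace`); transport along
  `P ↦ τ_* P` when the logarithm orders agree;
* §3 A222 INSTANTIATED at a good `p ≥ 5` split in `K`, `E` semistable with `ρ̄_{E,p}` irreducible:
  at an ERRATUM-TYPE field datum (`X11b.IsErratumField W K q`: `q ∣ d_K`, the other primes of `N_E`
  split — (Heeg) "split or ramified") and at a CLASSICAL Heegner datum (every `ℓ ∣ N_E` split) — a
  frame `(Ω_K ≠ 0, Ω_p ∈ R₀ˣ, L)` with `IsBDPLFunction ι' 𝔭_{ι'} κ γ f Ω_K Ω_p L` AND the value at `𝟙`.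

Every result is either pure algebra or CONDITIONAL on the published fact `h32`; nothing is asserted
about any class; no label moves. The X6 consumer is `X6RankOneHalvesFromPrint.lean`; lit-glue's
ordinary rows (C2/C3/C16 chains through `IMCLowerWaldspurgerOnTreeGoodAt`) may consume §2–§3 the same
way on semistable curves.

References: [Castella2018] §2.1, Thm. 2.3 (arXiv:1704.06608 p. 5), Thm. 3.1, display (3.2), Thm. 3.2
(p. 9), §5 (5.1) (p. 12); [JetchevSkinnerWan2017] §3.5 (arXiv:1512.06894 p. 16), §7.4.1 (p. 30);
[GrossLMS1991] §1; HOME/b2b-bsdres-lit-cw/CASTELLA-WAN.md §17.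
-/

set_option autoImplicit false

noncomputable section

open scoped Classical

open WeierstrassCurve NumberField IsDedekindDomain Field PowerSeries
  Literature.NumberTheory.EllipticCurves
  Literature.NumberTheory.EllipticCurves.ModularForms
  Literature.NumberTheory.EllipticCurves.Rank1Residual
  Literature.NumberTheory.EllipticCurves.Rank1Residual.Typed
  Literature.NumberTheory.EllipticCurves.Wuthrich2014
  Literature.NumberTheory.Automorphic
  Literature.NumberTheory.EllipticCurves.JetchevSkinnerWan2017
  Literature.NumberTheory.EllipticCurves.Castella2018
  Literature.NumberTheory.GaloisRepresentations
  Summit.BirchSwinnertonDyer.Rank1Residual.X11b.AcSelmer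
  Summit.BirchSwinnertonDyer.Rank1Residual.X11b.Halves
  Summit.BirchSwinnertonDyer.Rank1Residual.X11b.CongruenceLimit

namespace Summit.BirchSwinnertonDyer.Rank1Residual

namespace Supersingular

/-! ### §1 The algebra of a one-sided divisibility with a general value (every prime `p`) -/

section Algebra

variable (p : ℕ) [Fact p.Prime]

/-- From `p^{-n} ≤ (p^{-v})²` to `2v ≤ n`. [folklore] -/
theorem two_mul_le_of_zpow_le {n : ℕ} {v : ℤ}
    (h : (p : ℝ) ^ (-(n : ℤ)) ≤ ((p : ℝ) ^ (-v)) ^ 2) : 2 * v ≤ (n : ℤ) := by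
  have hp1 : (1 : ℝ) < p := by exact_mod_cast (Fact.out : p.Prime).one_lt
  have hrhs : ((p : ℝ) ^ (-v)) ^ 2 = (p : ℝ) ^ (-(2 * v)) := by
    rw [← zpow_natCast ((p : ℝ) ^ (-v)) 2, ← zpow_mul]
    congr 1
    push_cast
    ring
  rw [hrhs, zpow_le_zpow_iff_right₀ hp1] at h
  omega

/-- **The algebra of a ONE-SIDED divisibility, general value (every `p`).** If `f ∈ Λ = ℤ_p⟦T⟧` has
non-zero constant term (CTL₀), its image in `Λ_{R₀} = R₀⟦T⟧` lies in `(L)` (the divisibility), and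
`L(0) = u·y²` with `u ∈ R₀ˣ` and `y ∈ ℚ_p` (a value formula at `𝟙`), then `y ≠ 0` and
`2·ord_p y ≤ ord_p f(0)`. Proof by norms in `ℂ_p`: `f(0) = G(0)·L(0)`, `‖G(0)‖ ≤ 1`, `‖u‖ = 1`, so
`‖f(0)‖ ≤ ‖y‖²`. (Team x11b3's `Halves.two_mul_sub_one_le_valuation` is the case `y = (1 − a p⁻¹)·x`
with the bound `‖1 − a p⁻¹‖ ≤ p` spent; here the Euler-type factor stays inside `y`, so that its
EXACT valuation can be read off afterwards.) [folklore] -/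
theorem two_mul_valuation_le_of_mem_span {f : IwasawaAlgebra p} (hf0 : constantCoeff f ≠ 0)
    {L : UnrSeries p} (hfL : PowerSeries.map (toUnr p) f ∈ Ideal.span {L})
    (u : (unrIntegers p)ˣ) {y : ℚ_[p]}
    (hL : L.HasValueAt 0 (((u : unrIntegers p) : ℂ_[p]) * (algebraMap ℚ_[p] ℂ_[p] y) ^ 2)) :
    y ≠ 0 ∧ 2 * y.valuation ≤ ((constantCoeff f).valuation : ℤ) := by
  -- `L(0)` is the constant term
  have hL0 : ((u : unrIntegers p) : ℂ_[p]) * (algebraMap ℚ_[p] ℂ_[p] y) ^ 2 =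
      ((constantCoeff L : unrIntegers p) : ℂ_[p]) :=
    UnrSeries.eq_constantCoeff_of_hasValueAt_zero hL
  -- `f ↦ G·L`
  obtain ⟨G, hG⟩ := Ideal.mem_span_singleton'.mp hfL
  have hfac : algebraMap ℚ_[p] ℂ_[p] ((constantCoeff f : ℤ_[p]) : ℚ_[p]) =
      ((constantCoeff G : unrIntegers p) : ℂ_[p]) * ((constantCoeff L : unrIntegers p) : ℂ_[p]) := by
    rw [← coe_toUnr, ← constantCoeff_map_apply (toUnr p) f, ← hG, map_mul, Subring.coe_mul]
  -- norms
  have hnormf : ‖((constantCoeff f : ℤ_[p]) : ℚ_[p])‖ ≤ ‖y‖ ^ 2 := by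
    calc ‖((constantCoeff f : ℤ_[p]) : ℚ_[p])‖
        = ‖algebraMap ℚ_[p] ℂ_[p] ((constantCoeff f : ℤ_[p]) : ℚ_[p])‖ :=
          (norm_algebraMap' ℂ_[p] _).symm
      _ = ‖((constantCoeff G : unrIntegers p) : ℂ_[p])‖ *
            ‖((constantCoeff L : unrIntegers p) : ℂ_[p])‖ := by rw [hfac, norm_mul]
      _ ≤ 1 * ‖((constantCoeff L : unrIntegers p) : ℂ_[p])‖ :=
          mul_le_mul_of_nonneg_right (norm_coe_unrIntegers_le_one p _) (norm_nonneg _)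
      _ = ‖algebraMap ℚ_[p] ℂ_[p] y‖ ^ 2 := by
          rw [one_mul, ← hL0, norm_mul, norm_pow, norm_coe_units_unrIntegers, one_mul]
      _ = ‖y‖ ^ 2 := by rw [norm_algebraMap']
  -- `y ≠ 0`
  have hy0 : y ≠ 0 := by
    intro hy
    rw [hy, norm_zero, zero_pow two_ne_zero] at hnormf
    have h0 : ((constantCoeff f : ℤ_[p]) : ℚ_[p]) = 0 :=
      norm_eq_zero.mp (le_antisymm hnormf (norm_nonneg _))
    exact hf0 (PadicInt.coe_eq_zero.mp h0)
  refine ⟨hy0, two_mul_le_of_zpow_le p ?_⟩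
  rwa [← PadicInt.norm_def, PadicInt.norm_eq_zpow_neg_valuation hf0,
    Padic.norm_eq_zpow_neg_valuation hy0] at hnormf

/-- **The valuation of the good-`p` Euler-type factor**: for an integer `a` with `1 − a p⁻¹ + p⁻¹ ≠ 0`
in `ℚ_p` — in the application `a = a_p(E)`, `1 − a_p + p = #E(𝔽_p) > 0` —
`ord_p(1 − a p⁻¹ + p⁻¹) = ord_p(1 − a + p) − 1` (`1 − a p⁻¹ + p⁻¹ = (1 − a + p)/p`; Cas18 Thm. 2.3 /
Thm. 3.2 "`ε_p = p⁻¹` if `p ∤ N`"; JSW17 §3.5 "`(1 + p − a_p)/p`").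
[cite: Castella2018, Thm. 2.3 and Thm. 3.2 (arXiv:1704.06608 pp. 5, 9), the factor `1 − a_p p⁻¹ + ε_p`] -/
theorem valuation_one_sub_div_add_inv {a : ℤ}
    (h : (1 : ℚ_[p]) - (a : ℚ_[p]) * (p : ℚ_[p])⁻¹ + (p : ℚ_[p])⁻¹ ≠ 0) :
    ((1 : ℚ_[p]) - (a : ℚ_[p]) * (p : ℚ_[p])⁻¹ + (p : ℚ_[p])⁻¹).valuation =
      (padicValInt p (1 - a + p) : ℤ) - 1 := by
  have hpne : (p : ℚ_[p]) ≠ 0 := by exact_mod_cast (Fact.out : p.Prime).ne_zero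
  have hrew : (1 : ℚ_[p]) - (a : ℚ_[p]) * (p : ℚ_[p])⁻¹ + (p : ℚ_[p])⁻¹ =
      ((1 - a + p : ℤ) : ℚ_[p]) * (p : ℚ_[p])⁻¹ := by
    push_cast
    field_simp
    ring
  have hm0 : ((1 - a + p : ℤ) : ℚ_[p]) ≠ 0 := by
    intro h0
    apply h
    rw [hrew, h0, zero_mul]
  rw [hrew, Padic.valuation_mul hm0 (inv_ne_zero hpne), Padic.valuation_inv, Padic.valuation_p,
    Padic.valuation_intCast]
  ring

end Algebra

/-! ### §2 Pointwise at a GOOD prime (every embedding `ι : K → ℚ_p`): the halves give the composite -/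

section Pointwise

variable {K : Type} [Field K] [NumberField K] {W : WeierstrassCurve ℚ} [W.IsElliptic]
  [W.IsGloballyMinimal] {p : ℕ} [Fact p.Prime] {ι : K →+* ℚ_[p]}
  {P : (W.baseChange K).toAffine.Point} {κ : ZpExtension K p} {𝔭 : HeightOneSpectrum (𝓞 K)}
  {γ : Field.absoluteGaloisGroup K} [Fact (κ.IsTopGenerator γ)]

/-- **HALVES ⟹ the composite (IMC≥∘BDP)ᵍ, pointwise, at a GOOD prime `p`.** CTL₀
(`HasCharValuationAt … n`: `X_ac^∅(E_K[p^∞])` torsion with a generator of non-zero constant term of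
valuation `n`) ∧ the ONE-SIDED divisibility `Ch_Λ(X_ac)·R₀⟦T⟧ ⊆ (L)` ∧ the good-`p` value shape
`L(0) = u·((1 − a_p(E) p⁻¹ + p⁻¹)·log_{ω_E} P)²`, `u ∈ R₀ˣ` (Cas18 Thm. 3.2 with `ε_p = p⁻¹`, the
shape delivered by `Castella2018.thm32_exists_isBDPLFunction_valueAtOne` at `p ∤ N`) ⟹ lit-glue's
composite link `X11b.IMCLowerWaldspurgerOnTreeGoodAt p κ 𝔭 γ ι P` with the SAME `n`:
`2·(ord_p log_ω P + ord_p(1 − a_p + p) − 1) ≤ n`, `a_p = frobeniusTrace` of the minimal model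
(`= a_p(E) = W.LFunction p` at a good prime, `LFunction_apply_prime_eq_frobeniusTrace`); `log_ω P ≠ 0`
and `1 − a_p + p ≠ 0` come out, they are not put in. The good-`p` twin of team x11b3's
`Halves.imcLowerWaldspurgerOnTreeAt_of_value_of_dvd`.
[cite: Castella2018, Thm. 3.2 (arXiv:1704.06608 p. 9) and §5 (5.1) (p. 12) (the assembly, as an inequality)] -/
theorem imcLowerWaldspurgerOnTreeGoodAt_of_value_of_dvd (hgood : Good W p) {n : ℕ}
    (hn : XAc.HasCharValuationAt (W.baseChange K) p κ 𝔭 ∅ γ n) {L : UnrSeries p}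
    (h3 : (XAc.charIdeal (W.baseChange K) p κ 𝔭 ∅ γ).map (PowerSeries.map (toUnr p)) ≤
      Ideal.span {L})
    (u : (unrIntegers p)ˣ)
    (h2 : L.HasValueAt 0 (((u : unrIntegers p) : ℂ_[p]) *
      (algebraMap ℚ_[p] ℂ_[p]
        (((1 : ℚ_[p]) - (W.LFunction p : ℚ_[p]) * (p : ℚ_[p])⁻¹ + (p : ℚ_[p])⁻¹) *
          logOmega W p ι P)) ^ 2)) :
    X11b.IMCLowerWaldspurgerOnTreeGoodAt p κ 𝔭 γ ι P := by
  obtain ⟨htors, f, hf, hf0, hfn⟩ := hn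
  have hmem : PowerSeries.map (toUnr p) f ∈ Ideal.span {L} := by
    rw [hf, map_span_singleton_powerSeries] at h3
    exact (Ideal.span_singleton_le_iff_mem _).mp h3
  obtain ⟨hy0, hle⟩ := two_mul_valuation_le_of_mem_span p hf0 hmem u h2
  set c : ℚ_[p] := (1 : ℚ_[p]) - (W.LFunction p : ℚ_[p]) * (p : ℚ_[p])⁻¹ + (p : ℚ_[p])⁻¹ with hc
  have hc0 : c ≠ 0 := left_ne_zero_of_mul hy0
  have hx0 : logOmega W p ι P ≠ 0 := right_ne_zero_of_mul hy0
  have hcval : c.valuation = (padicValInt p (1 - W.frobeniusTrace p + p) : ℤ) - 1 := by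
    rw [← LFunction_apply_prime_eq_frobeniusTrace W p hgood]
    exact valuation_one_sub_div_add_inv p hc0
  refine ⟨n, ⟨htors, f, hf, hf0, hfn⟩, ?_⟩
  rw [← valuation_logOmega hx0, ← hfn]
  rw [Padic.valuation_mul hc0 hx0, hcval] at hle
  linarith

omit [W.IsElliptic] [W.IsGloballyMinimal] in
/-- Transport of the composite good-`p` link along `P ↦ P'` when the two logarithm orders agree (the
datum's point vs. its Galois conjugate). [folklore] -/
theorem imcLowerWaldspurgerOnTreeGoodAt_of_padicLogOrd_eq [W.IsElliptic] [W.IsGloballyMinimal]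
    {P P' : (W.baseChange K).toAffine.Point}
    (hlog : X11b.padicLogOrd W p ι P' = X11b.padicLogOrd W p ι P)
    (h : X11b.IMCLowerWaldspurgerOnTreeGoodAt p κ 𝔭 γ ι P') :
    X11b.IMCLowerWaldspurgerOnTreeGoodAt p κ 𝔭 γ ι P := by
  obtain ⟨n, hn, hle⟩ := h
  exact ⟨n, hn, by rw [← hlog]; exact hle⟩

end Pointwise

/-! ### §3 Castella 2018 Thms. 3.1–3.2 (A222) INSTANTIATED at a good `p` on the two X6 data shapes -/

section Instantiate

variable {p : ℕ} [Fact p.Prime] {W : WeierstrassCurve ℚ} [W.IsElliptic] [W.IsGloballyMinimal]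
  {K : Type} [Field K] [NumberField K]

omit [W.IsGloballyMinimal] in
/-- `p ∤ N_E` at a prime of good reduction. [folklore] -/
theorem not_dvd_conductorNorm_of_good (hgood : Good W p) : ¬ p ∣ W.conductorNorm ℤ := fun h ↦
  (W.dvd_conductorNorm_iff_not_hasGoodReductionAtPrime p).mp h hgood

/-- **Cas18 Thms. 3.1–3.2 INSTANTIATED at an ERRATUM-TYPE field datum at a good prime** (the data of
the X6 sub-locus statements: `K` an erratum-type field for `q` — `q ∣ d_K`, every other `ℓ ∣ N_E`
split, so (Heeg) "split or ramified" holds —, `p` split in `K`, a parametrisation datum `Dt` at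
level `N_E` with `p ∤ c` (display (3.2)), a Heegner datum `H`, `P'` with `P'.map w₀.embedding =
heegnerPointComplex Dt H`, anticyclotomic `(κ, γ)`, an embedding datum `ι'` and `e : K → ℚ_p` inducing
`𝔭_{ι'}`), for a SEMISTABLE `W` with `ρ̄_{E,p}` irreducible and `p ≥ 5`: a frame `(Ω_K ≠ 0, Ω_p, L)`
with `IsBDPLFunction ι' 𝔭_{ι'} κ γ f Ω_K Ω_p L` AND the value at `𝟙` in A222's raw shape
`L(0) = u·((1 − a_p(E) p⁻¹ + ε_p)·log_{ω_E} P')²`. CONDITIONAL on the published fact `h32`.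
[cite: Castella2018, Thm. 3.1, display (3.2) and Thm. 3.2 (arXiv:1704.06608 p. 9), §5 (p. 12) (the field)] -/
theorem X6.exists_frame_value_of_thm32_erratumField [NeZero (W.conductorNorm ℤ)] {q : ℕ}
    [Fact q.Prime] (h32 : thm32_exists_isBDPLFunction_valueAtOne) (ι' : PadicAlgCl p ≃+* ℂ)
    (Dt : ModularParametrizationData W (W.conductorNorm ℤ))
    (H : HeegnerDatum (W.conductorNorm ℤ) (NumberField.discr K)) (h5 : 5 ≤ p) (hss : Semistable W)
    (hirr : Irr W p) (hK : X11b.IsErratumField W K q) (hHp : SatisfiesHeegnerHypothesis p K)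
    (hc : ¬ (p : ℤ) ∣ Dt.c) (w₀ : InfinitePlace K) {P' : (W.baseChange K).toAffine.Point}
    (hP' : WeierstrassCurve.Affine.Point.map w₀.embedding.toRatAlgHom P' = heegnerPointComplex Dt H)
    (κ : ZpExtension K p) (hκ : κ.IsAnticyclotomic) (γ : Field.absoluteGaloisGroup K)
    (hγ : κ.IsTopGenerator γ) {e : K →+* ℚ_[p]}
    (he : ∀ k : 𝓞 K, k ∈ (X11b.primeOfEmbeddingDatum p ι' w₀.embedding).asIdeal ↔ ‖e (k : K)‖ < 1) :
    ∃ (ΩK : ℂ) (Ωp : (unrIntegers p)ˣ) (L : UnrSeries p), ΩK ≠ 0 ∧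
      IsBDPLFunction ι' (X11b.primeOfEmbeddingDatum p ι' w₀.embedding) κ γ Dt.f ΩK
        ((Ωp : unrIntegers p) : ℂ_[p]) L ∧
      ∃ u : (unrIntegers p)ˣ, L.HasValueAt 0
        (((u : unrIntegers p) : ℂ_[p]) *
          (algebraMap ℚ_[p] ℂ_[p]
            (((1 : ℚ_[p]) - (W.LFunction p : ℚ_[p]) * (p : ℚ_[p])⁻¹ +
                (if p ∣ W.conductorNorm ℤ then 0 else (p : ℚ_[p])⁻¹)) * logOmega W p e P')) ^ 2) :=
  h32 ι' W K (X11b.primeOfEmbeddingDatum p ι' w₀.embedding) κ γ Dt H w₀ e P' h5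
    (X11b.squarefree_conductorNorm_of_semistable hss) hirr hK.1 (hHp p Fact.out dvd_rfl)
    (X11b.natCast_mem_primeOfEmbeddingDatum p ι' w₀.embedding)
    (X11b.forall_mem_primeOfEmbeddingDatum_iff p ι' hK.1 w₀) (hK.forall_exists_absNorm_eq Fact.out)
    hκ hγ hc hP' he

/-- **Cas18 Thms. 3.1–3.2 INSTANTIATED at a CLASSICAL Heegner datum at a good prime** (every `ℓ ∣ N_E`
split in `K`, `p` split; the data of lit-glue's `X6.bsdp_of_thm331_of_onTreeGoodIMC_of_sprung`), for
a SEMISTABLE `W` of conductor `N` with `ρ̄_{E,p}` irreducible and `p ≥ 5`: frame + value at `𝟙` in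
A222's raw shape. CONDITIONAL on `h32`.
[cite: Castella2018, Thm. 3.1, display (3.2) and Thm. 3.2 (arXiv:1704.06608 p. 9)]
[cite: GrossLMS1991, §1 (p. 235)] -/
theorem X6.exists_frame_value_of_thm32_classical (h32 : thm32_exists_isBDPLFunction_valueAtOne)
    (ι' : PadicAlgCl p ≃+* ℂ) {N : ℕ} [NeZero N] (Dt : ModularParametrizationData W N)
    (H : HeegnerDatum N (NumberField.discr K)) (hN : W.conductorNorm ℤ = N) (h5 : 5 ≤ p)
    (hss : Semistable W) (hirr : Irr W p) (hK : IsImaginaryQuadratic K)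
    (hH : SatisfiesHeegnerHypothesis N K) (hHp : SatisfiesHeegnerHypothesis p K)
    (hc : ¬ (p : ℤ) ∣ Dt.c) (w₀ : InfinitePlace K) {P' : (W.baseChange K).toAffine.Point}
    (hP' : WeierstrassCurve.Affine.Point.map w₀.embedding.toRatAlgHom P' = heegnerPointComplex Dt H)
    (κ : ZpExtension K p) (hκ : κ.IsAnticyclotomic) (γ : Field.absoluteGaloisGroup K)
    (hγ : κ.IsTopGenerator γ) {e : K →+* ℚ_[p]}
    (he : ∀ k : 𝓞 K, k ∈ (X11b.primeOfEmbeddingDatum p ι' w₀.embedding).asIdeal ↔ ‖e (k : K)‖ < 1) :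
    ∃ (ΩK : ℂ) (Ωp : (unrIntegers p)ˣ) (L : UnrSeries p), ΩK ≠ 0 ∧
      IsBDPLFunction ι' (X11b.primeOfEmbeddingDatum p ι' w₀.embedding) κ γ Dt.f ΩK
        ((Ωp : unrIntegers p) : ℂ_[p]) L ∧
      ∃ u : (unrIntegers p)ˣ, L.HasValueAt 0
        (((u : unrIntegers p) : ℂ_[p]) *
          (algebraMap ℚ_[p] ℂ_[p]
            (((1 : ℚ_[p]) - (W.LFunction p : ℚ_[p]) * (p : ℚ_[p])⁻¹ +
                (if p ∣ N then 0 else (p : ℚ_[p])⁻¹)) * logOmega W p e P')) ^ 2) := by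
  have hsq : Squarefree N := hN ▸ X11b.squarefree_conductorNorm_of_semistable hss
  exact h32 ι' W K (X11b.primeOfEmbeddingDatum p ι' w₀.embedding) κ γ Dt H w₀ e P' h5 hsq hirr hK
    (hHp p Fact.out dvd_rfl) (X11b.natCast_mem_primeOfEmbeddingDatum p ι' w₀.embedding)
    (X11b.forall_mem_primeOfEmbeddingDatum_iff p ι' hK w₀)
    (fun ℓ hℓ hℓN ↦ X11b.exists_absNorm_eq_of_splitsIn hK.1 hℓ (hH ℓ hℓ hℓN)) hκ hγ hc hP' he

end Instantiate

/-! ### §3b Galois bookkeeping on an imaginary quadratic field (multr1's device, isolated) -/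

section Galois

variable {K : Type} [Field K] [NumberField K]

/-- Galois bookkeeping on an imaginary quadratic field (multr1's device, isolated): for any complex
embedding `ιK` of `K` and any infinite place `w₀` there is an involutive ring endomorphism `τ` of `K`
(an element of `Gal(K/ℚ)`) with `w₀.embedding ∘ τ = ιK`. [folklore] -/
theorem exists_involution_comp_eq (hK : IsImaginaryQuadratic K) (w₀ : InfinitePlace K)
    (ιK : K →+* ℂ) : ∃ τ : K →+* K, (∀ x, τ (τ x) = x) ∧ w₀.embedding.comp τ = ιK := by
  haveI : IsGalois ℚ K := by
    haveI : Algebra.IsQuadraticExtension ℚ K := ⟨hK.1⟩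
    infer_instance
  obtain ⟨σ, hσ⟩ := ComplexEmbedding.exists_comp_symm_eq_of_comp_eq (k := ℚ) w₀.embedding ιK
    (by ext x; simp)
  refine ⟨((σ.symm : K ≃ₐ[ℚ] K) : K →+* K), fun x ↦ ?_, ?_⟩
  · have hcard : Nat.card (K ≃ₐ[ℚ] K) = 2 := by rw [IsGalois.card_aut_eq_finrank, hK.1]
    have hsq : σ.symm * σ.symm = 1 := by
      have h := pow_card_eq_one' (G := K ≃ₐ[ℚ] K) (x := σ.symm)
      rwa [hcard, pow_two] at h
    have := congrArg (fun g : K ≃ₐ[ℚ] K ↦ g x) hsq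
    simpa [AlgEquiv.mul_apply] using this
  · ext x
    have := RingHom.congr_fun hσ x
    simpa using this

end Galois

end Supersingular

end Summit.BirchSwinnertonDyer.Rank1Residual

end
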